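import Literature.NumberTheory.LFunctions.TwistedRieszMean
import HarnessLib

/-!
# Matomäki–Radziwiłł 2016, Lemma 11 — the smoothed prime kernel via Riesz means

Topic `NumberTheory/Sieve`; second file of the reduction of the named fact
`Literature.NumberTheory.Sieve.MatomakiRadziwill2016_lemma11` (Halász inequality for primes; K. Matomäki,
M. Radziwiłł, *Multiplicative functions in short intervals*, Ann. of Math. 183 (2016), Lemma 11) to
the Vinogradov–Korobov zero-free region.  Everything here is PROVED.

The printed proof smooths the prime sum `∑_{P ≤ p ≤ 2P} log p · p^{i(t-t')}` with a compactly supported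
bump `f(n/P)` and evaluates `∑_n Λ(n) n^{it} f(n/P)` by an explicit formula, the Mellin transform `f̃`
supplying the off-diagonal decay `|f̃(1 + i(t - t'))| ≪ (1 + |t - t'|)^{-B}`.  We realise the same
mechanism with the **trapezoid** `W_P(n) = (5P/2 - n)₊ - (2P - n)₊ - (P - n)₊ + (P/2 - n)₊`
(`= P/2` on `[P, 2P]`, `≥ 0`, supported on `[P/2, 5P/2]`), a signed combination of four Riesz weights
`(x - n)₊` whose coefficients `c_i` satisfy `∑ c_i = ∑ c_i x_i = 0`.  For coefficients `b` with
`∑ b(n) n^{-s} = δ/(s - a) + G(s)` as in `TwistedRieszMean.TwistData` (model: `b(n) = Λ(n) n^{-iτ}`,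
`a = 1 - iτ`, `δ = 1`, `G = -ζ₁'/ζ₁(· + iτ)`), the tree's contour estimate
`TwistedRieszMean.TwistData.norm_rieszMean_sub_le` for the Riesz means `R(x) = ∑_{n ≤ x} b(n)(x - n)`
then gives (`MatomakiRadziwillL11.norm_sum_trapW_le`)

`‖∑_n b(n) W_P(n)‖ ≤ (23/2) P² (1/‖a(a+1)‖ + (2 log P + 2 + K₀)/T + 2B (P/2)^{σ₁-1} + 2B/T²)`:

the lower-order main terms `-x/a + 1/(a+1)` of the four Riesz means cancel in the combination
(`MatomakiRadziwillL11.mainTerm_comb`), leaving `∑ c_i x_i^{1+a}/(a(a+1))` of size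
`≪ P²/(1 + τ²)` — the substitute for the decay of `f̃` — while the error terms carry the saving
`(P/2)^{σ₁ - 1}` of the zero-free region.

* `MatomakiRadziwillL11.ramp`, `MatomakiRadziwillL11.trapW` — the weights; `trapW_nonneg`, `trapW_le`,
  `trapW_eq_half` (`= P/2` on `[P, 2P]`), `trapW_eq_ramps`.
* `MatomakiRadziwillL11.sum_mul_ramp_eq_rieszMeanC`, `sum_mul_trapW_eq` — `∑ b(n) W_P(n)` as the
  combination of Riesz means.
* `MatomakiRadziwillL11.mainTerm_comb`, `norm_mainTerm_comb_le`, `sq_add_one_le_norm` — the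
  cancellation and `‖a(a+1)‖ ≥ 1 + τ²` for `a = 1 - iτ`.
* `MatomakiRadziwillL11.norm_sum_trapW_le` — the kernel bound above.

## References

* K. Matomäki, M. Radziwiłł, Ann. of Math. (2) 183 (2016), 1015–1056, Lemma 11 (arXiv:1501.04585,
  pp. 11–12).
* H. L. Montgomery, R. C. Vaughan, *Multiplicative Number Theory I*, CUP 2007, §5.1 (Riesz means),
  §6.2. [MontgomeryVaughan2007]
-/

noncomputable section

open Finset Complex
open scoped ArithmeticFunction.vonMangoldt
open Literature.NumberTheory.LFunctions
open Literature.NumberTheory.LFunctions.TwistedRieszMean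

namespace Literature.NumberTheory.Sieve

namespace MatomakiRadziwillL11

/-! ### The ramp and the trapezoid -/

/-- The Riesz weight `(x - n)₊`. [cite: MontgomeryVaughan2007, §5.1 (5.19)] -/
def ramp (x : ℝ) (n : ℕ) : ℝ := max (x - n) 0

/-- `(x - n)₊ ≥ 0`. [folklore] -/
theorem ramp_nonneg (x : ℝ) (n : ℕ) : 0 ≤ ramp x n := le_max_right _ _

/-- Differences of ramps are clamped linear functions: for `a ≤ b`,
`(b - n)₊ - (a - n)₊ = min((b - n)₊, b - a)`. [folklore] -/
theorem ramp_sub_ramp {a b : ℝ} (hab : a ≤ b) (n : ℕ) :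
    ramp b n - ramp a n = min (max (b - n) 0) (b - a) := by
  unfold ramp
  rcases le_total (n : ℝ) a with h | h
  · rw [max_eq_left (by linarith), max_eq_left (by linarith), min_eq_right (by linarith)]
    ring
  · rcases le_total (n : ℝ) b with h' | h'
    · rw [max_eq_left (by linarith), max_eq_right (by linarith), min_eq_left (by linarith)]
      ring
    · rw [max_eq_right (by linarith), max_eq_right (by linarith), min_eq_left (by linarith)]
      ring

/-- The **trapezoid weight** `W_P(n)`: `0` for `n ≤ P/2`, rising linearly to `P/2` at `n = P`, equal to
`P/2` on `[P, 2P]`, decreasing linearly to `0` at `n = 5P/2` (written as a difference of two clamped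
ramps; see `trapW_eq_ramps`). [folklore] -/
def trapW (P : ℝ) (n : ℕ) : ℝ :=
  min (max (5 * P / 2 - n) 0) (P / 2) - min (max (P - n) 0) (P / 2)

/-- `W_P = (5P/2 - ·)₊ - (2P - ·)₊ - (P - ·)₊ + (P/2 - ·)₊`. [folklore] -/
theorem trapW_eq_ramps {P : ℝ} (hP : 0 ≤ P) (n : ℕ) :
    trapW P n = ramp (5 * P / 2) n - ramp (2 * P) n - ramp P n + ramp (P / 2) n := by
  have h1 := ramp_sub_ramp (show 2 * P ≤ 5 * P / 2 by linarith) n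
  have h2 := ramp_sub_ramp (show P / 2 ≤ P by linarith) n
  rw [show 5 * P / 2 - 2 * P = P / 2 by ring] at h1
  rw [show P - P / 2 = P / 2 by ring] at h2
  unfold trapW
  linarith

/-- `W_P ≥ 0`. [folklore] -/
theorem trapW_nonneg {P : ℝ} (hP : 0 ≤ P) (n : ℕ) : 0 ≤ trapW P n := by
  unfold trapW
  have : min (max (P - n) 0) (P / 2) ≤ min (max (5 * P / 2 - n) 0) (P / 2) :=
    min_le_min (max_le_max (by linarith) le_rfl) le_rfl
  linarith

/-- `W_P ≤ P/2`. [folklore] -/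
theorem trapW_le {P : ℝ} (hP : 0 ≤ P) (n : ℕ) : trapW P n ≤ P / 2 := by
  unfold trapW
  have h1 : min (max (5 * P / 2 - n) 0) (P / 2) ≤ P / 2 := min_le_right _ _
  have h2 : 0 ≤ min (max (P - n) 0) (P / 2) := le_min (le_max_right _ _) (by linarith)
  linarith

/-- `W_P = P/2` on `[P, 2P]`. [folklore] -/
theorem trapW_eq_half {P : ℝ} {n : ℕ} (h1 : P ≤ n) (h2 : (n : ℝ) ≤ 2 * P) : trapW P n = P / 2 := by
  unfold trapW
  rw [max_eq_left (by linarith : (0 : ℝ) ≤ 5 * P / 2 - n), min_eq_right (by linarith),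
    max_eq_right (by linarith : P - n ≤ 0), min_eq_left (by linarith)]
  ring

/-! ### `∑ b(n) W_P(n)` as a combination of Riesz means -/

/-- `∑_{0 < n ≤ N} b(n) (x - n)₊ = R(x) = ∑_{n ≤ x} b(n)(x - n)` once `N ≥ ⌊x⌋`. [folklore] -/
theorem sum_mul_ramp_eq_rieszMeanC (b : ℕ → ℂ) {x : ℝ} (hx : 0 ≤ x) {N : ℕ} (hN : ⌊x⌋₊ ≤ N) :
    ∑ n ∈ Ioc 0 N, b n * (ramp x n : ℂ) = rieszMeanC b x := by
  rw [rieszMeanC, ← Finset.sum_Ioc_consecutive _ (Nat.zero_le _) hN]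
  have h2 : ∑ n ∈ Ioc ⌊x⌋₊ N, b n * (ramp x n : ℂ) = 0 := by
    refine Finset.sum_eq_zero fun n hn => ?_
    have hn' : x < n := (Nat.floor_lt hx).1 (Finset.mem_Ioc.1 hn).1
    rw [ramp, max_eq_right (by linarith)]
    simp
  rw [h2, add_zero]
  refine Finset.sum_congr rfl fun n hn => ?_
  have hn' : (n : ℝ) ≤ x :=
    le_trans (by exact_mod_cast (Finset.mem_Ioc.1 hn).2) (Nat.floor_le hx)
  rw [ramp, max_eq_left (by linarith)]
  push_cast
  ring

/-- `∑_{0 < n ≤ N} b(n) W_P(n) = R(5P/2) - R(2P) - R(P) + R(P/2)` once `N ≥ ⌊5P/2⌋`. [folklore] -/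
theorem sum_mul_trapW_eq (b : ℕ → ℂ) {P : ℝ} (hP : 0 ≤ P) {N : ℕ} (hN : ⌊5 * P / 2⌋₊ ≤ N) :
    ∑ n ∈ Ioc 0 N, b n * (trapW P n : ℂ) =
      rieszMeanC b (5 * P / 2) - rieszMeanC b (2 * P) - rieszMeanC b P + rieszMeanC b (P / 2) := by
  have hN1 : ⌊2 * P⌋₊ ≤ N := le_trans (Nat.floor_le_floor (by linarith)) hN
  have hN2 : ⌊P⌋₊ ≤ N := le_trans (Nat.floor_le_floor (by linarith)) hN
  have hN3 : ⌊P / 2⌋₊ ≤ N := le_trans (Nat.floor_le_floor (by linarith)) hN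
  rw [← sum_mul_ramp_eq_rieszMeanC b (by linarith) hN, ← sum_mul_ramp_eq_rieszMeanC b (by linarith) hN1,
    ← sum_mul_ramp_eq_rieszMeanC b hP hN2, ← sum_mul_ramp_eq_rieszMeanC b (by linarith) hN3,
    ← Finset.sum_sub_distrib, ← Finset.sum_sub_distrib, ← Finset.sum_add_distrib]
  refine Finset.sum_congr rfl fun n _ => ?_
  rw [trapW_eq_ramps hP]
  push_cast
  ring

/-! ### The main terms cancel to second order -/

/-- **Cancellation of the lower-order main terms.**  With `M(x) = x^{1+a}/(a(a+1)) - x/a + 1/(a+1)`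
(`TwistedRieszMean.mainTerm`), the trapezoid combination is
`M(5P/2) - M(2P) - M(P) + M(P/2) = ((5P/2)^{1+a} - (2P)^{1+a} - P^{1+a} + (P/2)^{1+a})/(a(a+1))`,
because the coefficients `(1, -1, -1, 1)` annihilate both `1` and `x`. [folklore] -/
theorem mainTerm_comb (a : ℂ) (P : ℝ) :
    mainTerm a (5 * P / 2) - mainTerm a (2 * P) - mainTerm a P + mainTerm a (P / 2) =
      ((((5 * P / 2 : ℝ) : ℂ)) ^ (1 + a) - (((2 * P : ℝ) : ℂ)) ^ (1 + a) - ((P : ℝ) : ℂ) ^ (1 + a)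
        + (((P / 2 : ℝ) : ℂ)) ^ (1 + a)) / (a * (a + 1)) := by
  simp only [mainTerm]
  push_cast
  ring

/-- `‖x^{1+a}‖ = x²` for `x > 0` and `Re a = 1`. [folklore] -/
theorem norm_cpow_one_add {a : ℂ} (ha : a.re = 1) {x : ℝ} (hx : 0 < x) :
    ‖((x : ℝ) : ℂ) ^ (1 + a)‖ = x ^ 2 := by
  rw [Complex.norm_cpow_eq_rpow_re_of_pos hx, Complex.add_re, Complex.one_re, ha,
    show (1 : ℝ) + 1 = (2 : ℕ) by norm_num, Real.rpow_natCast]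

/-- **Size of the surviving main term**: for `Re a = 1` and `P > 0`,
`‖M(5P/2) - M(2P) - M(P) + M(P/2)‖ ≤ (23/2) P²/‖a(a+1)‖` (`25/4 + 4 + 1 + 1/4 = 23/2`). [folklore] -/
theorem norm_mainTerm_comb_le {a : ℂ} (ha : a.re = 1) {P : ℝ} (hP : 0 < P) :
    ‖mainTerm a (5 * P / 2) - mainTerm a (2 * P) - mainTerm a P + mainTerm a (P / 2)‖ ≤
      23 / 2 * P ^ 2 / ‖a * (a + 1)‖ := by
  rw [mainTerm_comb, norm_div]
  refine div_le_div_of_nonneg_right ?_ (norm_nonneg _)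
  have h1 := norm_cpow_one_add ha (show 0 < 5 * P / 2 by linarith)
  have h2 := norm_cpow_one_add ha (show 0 < 2 * P by linarith)
  have h3 := norm_cpow_one_add ha hP
  have h4 := norm_cpow_one_add ha (show 0 < P / 2 by linarith)
  calc ‖(((5 * P / 2 : ℝ) : ℂ)) ^ (1 + a) - (((2 * P : ℝ) : ℂ)) ^ (1 + a) - ((P : ℝ) : ℂ) ^ (1 + a)
        + (((P / 2 : ℝ) : ℂ)) ^ (1 + a)‖
      ≤ ‖(((5 * P / 2 : ℝ) : ℂ)) ^ (1 + a)‖ + ‖(((2 * P : ℝ) : ℂ)) ^ (1 + a)‖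
          + ‖((P : ℝ) : ℂ) ^ (1 + a)‖ + ‖(((P / 2 : ℝ) : ℂ)) ^ (1 + a)‖ := by
        refine (norm_add_le _ _).trans (add_le_add ?_ le_rfl)
        refine (norm_sub_le _ _).trans (add_le_add ?_ le_rfl)
        exact norm_sub_le _ _
    _ = (5 * P / 2) ^ 2 + (2 * P) ^ 2 + P ^ 2 + (P / 2) ^ 2 := by rw [h1, h2, h3, h4]
    _ = 23 / 2 * P ^ 2 := by ring

/-- For `a = 1 - iτ`: `‖a(a+1)‖ ≥ 1 + τ²` (`‖a‖² = 1 + τ²`, `‖a + 1‖² = 4 + τ² ≥ ‖a‖²`). [folklore] -/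
theorem sq_add_one_le_norm (τ : ℝ) :
    1 + τ ^ 2 ≤ ‖(1 - τ * I) * (1 - τ * I + 1)‖ := by
  have h1 : ‖(1 - τ * I : ℂ)‖ ^ 2 = 1 + τ ^ 2 := by
    rw [Complex.sq_norm, Complex.normSq_apply]
    simp only [Complex.sub_re, Complex.one_re, Complex.mul_re, Complex.ofReal_re, Complex.I_re,
      Complex.ofReal_im, Complex.I_im, Complex.sub_im, Complex.one_im, Complex.mul_im]
    ring
  have h2 : ‖(1 - τ * I + 1 : ℂ)‖ ^ 2 = 4 + τ ^ 2 := by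
    rw [Complex.sq_norm, Complex.normSq_apply]
    simp only [Complex.add_re, Complex.sub_re, Complex.one_re, Complex.mul_re, Complex.ofReal_re,
      Complex.I_re, Complex.ofReal_im, Complex.I_im, Complex.add_im, Complex.sub_im, Complex.one_im,
      Complex.mul_im]
    ring
  have h3 : ‖(1 - τ * I : ℂ)‖ ≤ ‖(1 - τ * I + 1 : ℂ)‖ :=
    (sq_le_sq₀ (norm_nonneg _) (norm_nonneg _)).1 (by rw [h1, h2]; linarith)
  rw [norm_mul, ← h1, sq]
  exact mul_le_mul_of_nonneg_left h3 (norm_nonneg _)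

/-! ### The kernel bound -/

/-- `log(5P/2) ≤ log P + 1` for `P > 0` (`5/2 < e`). [folklore] -/
theorem log_five_half_mul_le {P : ℝ} (hP : 0 < P) : Real.log (5 * P / 2) ≤ Real.log P + 1 := by
  rw [show 5 * P / 2 = 5 / 2 * P by ring, Real.log_mul (by norm_num) hP.ne']
  have : Real.log (5 / 2) < 1 := by
    rw [Real.log_lt_iff_lt_exp (by norm_num)]
    have := Real.exp_one_gt_d9
    linarith
  linarith

/-- **The smoothed prime kernel.**  Under `TwistData b G δ a σ₁ T B` (so `∑ b(n) n^{-s} = δ/(s-a) + G(s)`,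
`|b| ≤ Λ`, `|δ| ≤ 1`, `Re a = 1`, `G` holomorphic and bounded by `B` on `[σ₁, 2] × [-T, T]`) and the
absolute Dirichlet-series bound `K₀` of `TwistedRieszMean.exists_norm_LSeries_le`, for `P ≥ 16` and
`N ≥ ⌊5P/2⌋`:
`‖∑_{0 < n ≤ N} b(n) W_P(n)‖ ≤ (23/2) P² (1/‖a(a+1)‖ + (2 log P + 2 + K₀)/T + 2B (P/2)^{σ₁-1} + 2B/T²)`.
Proof: `∑ b W_P = ∑ c_i R(x_i)` (`sum_mul_trapW_eq`), each `R(x_i) = δ M(x_i) + O(x_i² E(x_i))` by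
`TwistedRieszMean.TwistData.norm_rieszMean_sub_le` (`x_i ≥ P/2 ≥ e²`), `∑ c_i δ M(x_i)` is bounded by
`norm_mainTerm_comb_le`, and `∑ x_i² = (23/2) P²`, `log x_i ≤ log P + 1`, `x_i^{σ₁-1} ≤ (P/2)^{σ₁-1}`.
This is the analogue of the displayed evaluation of `∑ Λ(n) n^{it} f(n/P)` in the proof of Lemma 11.
[cite: MatomakiRadziwillAnnals2016, Lemma 11 (proof)] -/
theorem norm_sum_trapW_le {b : ℕ → ℂ} {G : ℂ → ℂ} {δ a : ℂ} {σ₁ T B : ℝ}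
    (h : TwistData b G δ a σ₁ T B) {K₀ : ℝ} (hK₀ : 0 ≤ K₀)
    (hK : ∀ (b : ℕ → ℂ), (∀ n, ‖b n‖ ≤ Λ n) → ∀ s : ℂ, 1 < s.re → s.re ≤ 2 →
      ‖LSeries b s‖ ≤ 1 / (s.re - 1) + K₀)
    {P : ℝ} (hP : 16 ≤ P) {N : ℕ} (hN : ⌊5 * P / 2⌋₊ ≤ N) :
    ‖∑ n ∈ Ioc 0 N, b n * (trapW P n : ℂ)‖ ≤
      23 / 2 * P ^ 2 * (1 / ‖a * (a + 1)‖
        + ((2 * Real.log P + 2 + K₀) / T + 2 * B * (P / 2) ^ (σ₁ - 1) + 2 * B / T ^ 2)) := by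
  have hP0 : 0 < P := by linarith
  have hT : 0 < T := by linarith [h.one_le]
  have hB := h.nonneg
  have hσ : σ₁ - 1 ≤ 0 := by linarith [h.le_one]
  -- `e² ≤ 8 ≤ P/2`
  have he2 : Real.exp 2 ≤ P / 2 := by
    have := Real.exp_one_lt_d9
    have h' : Real.exp 2 = Real.exp 1 * Real.exp 1 := by rw [← Real.exp_add]; norm_num
    nlinarith [Real.exp_pos 1]
  -- the four Riesz means
  set x₁ : ℝ := 5 * P / 2 with hx₁
  set x₂ : ℝ := 2 * P with hx₂
  set x₃ : ℝ := P with hx₃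
  set x₄ : ℝ := P / 2 with hx₄
  set Emax : ℝ := (2 * Real.log P + 2 + K₀) / T + 2 * B * (P / 2) ^ (σ₁ - 1) + 2 * B / T ^ 2
    with hEmax
  -- the generic estimate for `P/2 ≤ x ≤ 5P/2`
  have hgen : ∀ x : ℝ, P / 2 ≤ x → x ≤ 5 * P / 2 →
      ‖rieszMeanC b x - δ * mainTerm a x‖ ≤ x ^ 2 * Emax := by
    intro x hxl hxu
    have hx0 : 0 < x := by linarith
    have h1 := h.norm_rieszMean_sub_le hK₀ hK (le_trans he2 hxl)
    refine h1.trans (mul_le_mul_of_nonneg_left ?_ (sq_nonneg x))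
    have hlog : Real.log x ≤ Real.log P + 1 :=
      (Real.log_le_log hx0 hxu).trans (log_five_half_mul_le hP0)
    have hpow : x ^ (σ₁ - 1) ≤ (P / 2) ^ (σ₁ - 1) :=
      Real.rpow_le_rpow_of_nonpos (by linarith) hxl hσ
    have t1 : (2 * Real.log x + K₀) / T ≤ (2 * Real.log P + 2 + K₀) / T :=
      div_le_div_of_nonneg_right (by linarith) hT.le
    have t2 : 2 * B * x ^ (σ₁ - 1) ≤ 2 * B * (P / 2) ^ (σ₁ - 1) :=
      mul_le_mul_of_nonneg_left hpow (by positivity)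
    rw [hEmax]
    linarith
  have e1 := hgen x₁ (by rw [hx₁]; linarith) (by rw [hx₁])
  have e2 := hgen x₂ (by rw [hx₂]; linarith) (by rw [hx₂]; linarith)
  have e3 := hgen x₃ (by rw [hx₃]; linarith) (by rw [hx₃]; linarith)
  have e4 := hgen x₄ (by rw [hx₄]) (by rw [hx₄]; linarith)
  -- the main term
  have hmain : ‖δ * (mainTerm a x₁ - mainTerm a x₂ - mainTerm a x₃ + mainTerm a x₄)‖ ≤
      23 / 2 * P ^ 2 / ‖a * (a + 1)‖ := by
    rw [norm_mul]
    have hm := norm_mainTerm_comb_le h.a_re hP0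
    calc ‖δ‖ * ‖mainTerm a x₁ - mainTerm a x₂ - mainTerm a x₃ + mainTerm a x₄‖
        ≤ 1 * (23 / 2 * P ^ 2 / ‖a * (a + 1)‖) :=
          mul_le_mul h.norm_delta_le hm (norm_nonneg _) zero_le_one
      _ = _ := one_mul _
  -- assemble
  rw [sum_mul_trapW_eq b hP0.le hN]
  have hsplit : rieszMeanC b x₁ - rieszMeanC b x₂ - rieszMeanC b x₃ + rieszMeanC b x₄ =
      (rieszMeanC b x₁ - δ * mainTerm a x₁) - (rieszMeanC b x₂ - δ * mainTerm a x₂)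
        - (rieszMeanC b x₃ - δ * mainTerm a x₃) + (rieszMeanC b x₄ - δ * mainTerm a x₄)
        + δ * (mainTerm a x₁ - mainTerm a x₂ - mainTerm a x₃ + mainTerm a x₄) := by ring
  rw [hsplit]
  have hsq : x₁ ^ 2 + x₂ ^ 2 + x₃ ^ 2 + x₄ ^ 2 = 23 / 2 * P ^ 2 := by
    rw [hx₁, hx₂, hx₃, hx₄]; ring
  have hEmax0 : 0 ≤ Emax := by
    have hlogP : 0 ≤ Real.log P := Real.log_nonneg (by linarith)
    have h1 : 0 ≤ (2 * Real.log P + 2 + K₀) / T := div_nonneg (by linarith) hT.le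
    have h2 : 0 ≤ 2 * B * (P / 2) ^ (σ₁ - 1) := by positivity
    have h3 : 0 ≤ 2 * B / T ^ 2 := by positivity
    rw [hEmax]; linarith
  calc ‖(rieszMeanC b x₁ - δ * mainTerm a x₁) - (rieszMeanC b x₂ - δ * mainTerm a x₂)
        - (rieszMeanC b x₃ - δ * mainTerm a x₃) + (rieszMeanC b x₄ - δ * mainTerm a x₄)
        + δ * (mainTerm a x₁ - mainTerm a x₂ - mainTerm a x₃ + mainTerm a x₄)‖
      ≤ ‖rieszMeanC b x₁ - δ * mainTerm a x₁‖ + ‖rieszMeanC b x₂ - δ * mainTerm a x₂‖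
          + ‖rieszMeanC b x₃ - δ * mainTerm a x₃‖ + ‖rieszMeanC b x₄ - δ * mainTerm a x₄‖
          + ‖δ * (mainTerm a x₁ - mainTerm a x₂ - mainTerm a x₃ + mainTerm a x₄)‖ := by
        refine (norm_add_le _ _).trans (add_le_add ?_ le_rfl)
        refine (norm_add_le _ _).trans (add_le_add ?_ le_rfl)
        refine (norm_sub_le _ _).trans (add_le_add ?_ le_rfl)
        exact norm_sub_le _ _
    _ ≤ x₁ ^ 2 * Emax + x₂ ^ 2 * Emax + x₃ ^ 2 * Emax + x₄ ^ 2 * Emax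
          + 23 / 2 * P ^ 2 / ‖a * (a + 1)‖ := by
        gcongr
    _ = 23 / 2 * P ^ 2 * (1 / ‖a * (a + 1)‖ + Emax) := by
        rw [← hsq]; ring

end MatomakiRadziwillL11

end Literature.NumberTheory.Sieve
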